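import Mathlib
import Summits.Ventures.PercRepro2.TypedMarkedSeriesDefs

/-!
# Marked series vertices: the kernel identities, rule A — types (1, 1) and (1, 2) (blind cell PercRepro2,
night-3 g13, 2026-08-27; `proofs/NIGHT3-CERT.md` §22)

For every consistent signature triple (the partitions of the four marks other than the degree-two
mark, in the three copies), the nine-term colouring sum `S9` of the `S₃`-symmetrised kernel over the
two edges at the marked series vertex vanishes: `o` with exactly the edges `{a₁, o}`, `{o, a₃}` (`modelA`).  Checked by `decide` (15³ consistent
signature triples per type pair, the inconsistent ones cut by the nested guards).
-/

namespace Summit.Ventures.PercRepro2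

namespace CovForm

namespace MarkedSeries

open OneTyped Untouched

/-- The identity for rule A, `e` of type `1`, `f` of type `1`. -/
theorem identA_11 : ∀ (c12 c1b c13 c2b c23 cb3 : Bool), consB c12 c1b c13 c2b c23 cb3 = true →
    ∀ (d12 d1b d13 d2b d23 db3 : Bool), consB d12 d1b d13 d2b d23 db3 = true →
    ∀ (e12 e1b e13 e2b e23 eb3 : Bool), consB e12 e1b e13 e2b e23 eb3 = true →
    S9 1 1 (modelA c12 c1b c13 c2b c23 cb3) (modelA d12 d1b d13 d2b d23 db3)
      (modelA e12 e1b e13 e2b e23 eb3) = 0 := by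
  decide +kernel

/-- The identity for rule A, `e` of type `1`, `f` of type `2`. -/
theorem identA_12 : ∀ (c12 c1b c13 c2b c23 cb3 : Bool), consB c12 c1b c13 c2b c23 cb3 = true →
    ∀ (d12 d1b d13 d2b d23 db3 : Bool), consB d12 d1b d13 d2b d23 db3 = true →
    ∀ (e12 e1b e13 e2b e23 eb3 : Bool), consB e12 e1b e13 e2b e23 eb3 = true →
    S9 1 2 (modelA c12 c1b c13 c2b c23 cb3) (modelA d12 d1b d13 d2b d23 db3)
      (modelA e12 e1b e13 e2b e23 eb3) = 0 := by
  decide +kernel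


end MarkedSeries

end CovForm

end Summit.Ventures.PercRepro2
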